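import Literature.MathematicalPhysics.QuantumFieldTheory.Balaban1983to89.B9Ineq377POneConcrete
import Literature.MathematicalPhysics.QuantumFieldTheory.Balaban1983to89.B9Ineq349Hom

/-!
# `Balaban1983to89.B9Ineq349PConcrete` — [Balaban1985BackgroundPropagators] Theorem 3.4 p. 400, `G`-clause (entries (3.42)₁, (3.42)₃)
# with `V₃(A)` (3.82), `P₁(A)` (3.76) concrete AND the projection `P(U) = G′Q′*(Q′G′²Q′*)⁻¹Q′G′` of (3.25) WRITTEN OUT, its (3.49)-entries
# DERIVED from Theorem 3.1 (3.42)₁,₂,₃ for `G′(U)`, Theorem 3.2 (3.48) and the block-locality of `Q′(U)` (3.19) — FILE 13 of the Sect. B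
# programme = FILE 11's `thm34_G_entries13_concreteV₃P₁` with its three `P`-entry hypotheses `hP`/`hDP`/`hPDs` discharged by FILE 12's
# `B9Ineq349Hom.ineq349_hom`

statement-level skeleton of published theorems with citation tags; proofs where landed; nothing here is a claim about the Yang–Mills mass gap

DOCFIX (cell `lit-balaban`, seat r06 gen 15, 2026-08-22; p37 `CITELOC-SWEEP-B4B9.md` §2b page-numeral slips, text layer re-read): (3.19) is p. 393 [PDF 5] ((3.20)–(3.25) p. 394) — the locators of (3.19) in this file corrected accordingly (2 place(s)); declarations, statements and proofs byte-identical to the tree copy of record (p312650).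

CITATION HEADER (lean-in-tree rule).  B9 = T. Bałaban, *Propagators for lattice gauge theories in a background field*, Commun. Math. Phys.
**99** (1985) 389–434 [Balaban1985BackgroundPropagators] (held `paper:balaban1985-cmp99-background-propagators`; journal page = PDF page + 388):
Thm 3.4 p. 400; (3.25) p. 394 («Rf = (I − G′Q′*(Q′G′²Q′*)⁻¹Q′G′)f»); (3.49) p. 399 («For the operator P = I − R we obtain, using again Lemma 2.1, …»);
Theorem 3.1 (3.42) p. 397, Theorem 3.2 (3.48) p. 398 and the scale-transfer remark p. 398; (3.19) p. 393; (3.76)–(3.77) pp. 405–406; (3.82)–(3.86)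
p. 407; (3.68) p. 403; (3.37)/(3.35) p. 396.  [4] = [Balaban1984PropagatorsII]: Lemma 2.1 p. 234, (2.51)–(2.55) p. 232, (2.66) p. 234.  [B11] =
[Balaban1985Variational] (135) p. 298 (the curvature commutator, through file 7).  Cell `lit-balaban`, seat r06 (B9 fold owner) gen 12, FILE 13;
rows B9.Thm3.4 × B9.Eq3.49 × B9.Eq3.25 × B9.Eq3.76 × B9.Eq3.85.

THE PRINT.  p. 400: «Theorem 3.4. There exists a positive constant a₁ such that the operators G′(U), (Q′(U)G′²(U)Q′*(U))⁻¹, R(U), G(U) extend to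
configurations U′U for α₁ ≦ a₁ as analytic functions of A. The extended operators satisfy all the inequalities of Theorems 3.1–3.3 correspondingly.»
p. 399: «These theorems imply all the properties of the operator R, or DRD\*, we will need in the future. For the operator P = I − R we obtain, using
again Lemma 2.1, [the bounds (3.49)]».  The route of the print for the `G`-clause (pp. 405–407): `Δ_a(U′U) = Δ_a(U) − V(A)` with `V = V₃ + P₁ + P₂`
((3.84)), `|V(A)G(U)| ≦ O(1)α₁` ((3.85)), Neumann series (3.86); the `P₁`-term is bounded by (3.77) from (3.49), (3.68), (3.70)/(3.74).

WHAT THIS FILE PROVES (one theorem; 0 `def`; 0 sorry; standard axioms).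
* **`thm34_G_entries13_concreteP`** — FILE 11's `B9Ineq377POneConcrete.thm34_G_entries13_concreteV₃P₁` (Theorem 3.4's `G`-clause, entries (3.42)₁
  and (3.42)₃, for the concrete `V₃(A)` and the concrete `P₁(A)`) in which the abstract site-carrier letter `P = P(U)` is REPLACED by the printed word
  `G′ ∘ Q′* ∘ (Q′G′²Q′*)⁻¹ ∘ Q′ ∘ G′` of (3.25) — `G′ = G′(U)` an endomorphism of the real site coordinates `S × ι`, `Q′ : (S × ι → ℝ) → (Z → ℝ)` to a
  coarse lattice `Z` (block map `blkZ`), `Q′*` back, `(Q′G′²Q′*)⁻¹` an endomorphism of `Z → ℝ` — and the three hypotheses `hP`, `hDP`, `hPDs` of FILE 11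
  (the (3.49) entries `|P|`, `|DP|`, `|PD*|` at the rate `δ_P`) are DISCHARGED by `B9Ineq349Hom.ineq349_hom` from: Theorem 3.1 (3.42)₁ for `G′(U)`
  (`hGp`), (3.42)₂ for the CONCRETE `D ∘ G′(U)`, `D = conjHom b (η⁻¹D¹_U)` (`hDGp`), (3.42)₃ for the CONCRETE `G′(U) ∘ D*` (`hGpDs`), Theorem 3.2 (3.48)
  for `(Q′G′²Q′*)⁻¹` (`hCinv`), `Q′`/`Q′*` block-local with norm `κ_Q` (`hQ`, `hQs`), all at a rate `δ_G ≧ δ_P + (2α+β)δ₀`, plus the scale transfer of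
  `(Lʲη)⁻⁴` (`hT4`, the p. 398 remark at `γ = −4`); `κ_P = κ₃₄₉(κ_Q, B_G, B₁, Λ, c₁(β))` (kept as a parameter bound by `hκP`).  Everything else is
  FILE 11's signature verbatim (`DRD* = D ∘ (1 − P) ∘ D*`, `D′R′D′* = D′ ∘ (1 − (P + P′)) ∘ D′*` now with `P` written out).

HONEST SCOPE / NOT CLAIMED.  Still INPUTS of printed shape: Theorems 3.1/3.2 for `U` (as block majorants — the cell's typed Theorem 3.1 delivers them
through `B9Thm37GlueCor36.hasMajorantHom_of_thm31` for operators realizing its observation quantities), Theorem 3.3's entries for `G(U)`, the (3.68)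
entries of `P′(A)` (`hPp`/`hDPp`/`hPpDs`/`hDPpDs`; one-carrier derivations exist: `B9Ineq368PPrime.ineq368_op`, `B9Ineq368Vprime`), `P₂`/(3.80)/(3.83),
`Δ_a(U)G(U) = G(U)Δ_a(U) = 1`, the (3.35)/(3.37) blockwise shapes, kernel ↔ block identification; operator (block `L^∞`) form throughout; entries
(3.42)₂,₄ and (3.43)–(3.47) not here.  No row head changes.  NOT summit progress.

RELATED IN THE TREE, NOT DUPLICATED (searched 2026-08-22: `lean search 'concreteP\b|Ineq349PConcrete|thm34_G_entries13_concreteP'` = ∅): FILE 11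
`B9Ineq377POneConcrete` and FILE 12 `B9Ineq349Hom` are used BY NAME; nothing restated.
-/

noncomputable section

namespace Literature.MathematicalPhysics.QuantumFieldTheory.Balaban1983to89.B9Ineq349PConcrete

open NormedSpace Complex
open Literature.MathematicalPhysics.QuantumFieldTheory.Balaban1983to89
open Literature.MathematicalPhysics.QuantumFieldTheory.Balaban1983to89.B6RandomWalk (HasMajorant Triangle254 Ineq261)
open Literature.MathematicalPhysics.QuantumFieldTheory.Balaban1983to89.B6RandomWalkHom (HasMajorantHom)
open Literature.MathematicalPhysics.QuantumFieldTheory.Balaban1983to89.B9Thm34Ext (toB6)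
open Literature.MathematicalPhysics.QuantumFieldTheory.Balaban1983to89.B9Ineq347 (ScaleTransfer)
open Literature.MathematicalPhysics.QuantumFieldTheory.Balaban1983to89.B9Eq386Neumann (pTwo deltaA)
open Literature.MathematicalPhysics.QuantumFieldTheory.Balaban1983to89.B9Ineq377POne (kappa377)
open Literature.MathematicalPhysics.QuantumFieldTheory.Balaban1983to89.B9Ineq385VG (kappa385)
open Literature.MathematicalPhysics.QuantumFieldTheory.Balaban1983to89.B9Eq39Adjoint
open Literature.MathematicalPhysics.QuantumFieldTheory.Balaban1983to89.B9Eq369Small (Through)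
open Literature.MathematicalPhysics.QuantumFieldTheory.Balaban1983to89.B9Eq372Locality (stBonds)
open Literature.MathematicalPhysics.QuantumFieldTheory.Balaban1983to89.B9Eq352DivForm (tauF tauB)
open Literature.MathematicalPhysics.QuantumFieldTheory.Balaban1983to89.B9Eq352DivFormLetters
open Literature.MathematicalPhysics.QuantumFieldTheory.Balaban1983to89.B9Eq352GradLetters (diffLetter)
open Literature.MathematicalPhysics.QuantumFieldTheory.Balaban1983to89.B9Eq371GradLetters (bT bU)
open Literature.MathematicalPhysics.QuantumFieldTheory.Balaban1983to89.B9Eq372RemLetters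
open Literature.MathematicalPhysics.QuantumFieldTheory.Balaban1983to89.B9Eq382V3Letters
open Literature.MathematicalPhysics.QuantumFieldTheory.Balaban1983to89.B9Ineq385V3Concrete (cV385)
open Literature.MathematicalPhysics.QuantumFieldTheory.Balaban1983to89.B9Eq376POneLetters
open Literature.MathematicalPhysics.QuantumFieldTheory.Balaban1983to89.B9Ineq377POneConcrete (thm34_G_entries13_concreteV₃P₁)
open Literature.MathematicalPhysics.QuantumFieldTheory.Balaban1983to89.B9Ineq368PPrime (kappa349)
open Literature.MathematicalPhysics.QuantumFieldTheory.Balaban1983to89.B9Ineq349Hom (ineq349_hom)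

section Assembly

variable {𝔸 : Type*} [NormedRing 𝔸] [NormedAlgebra ℂ 𝔸] [CompleteSpace 𝔸] {ι : Type} [Fintype ι]
variable (b : Module.Basis ι ℝ 𝔸) {S : Type} {κ : Type} [Fintype κ] [LinearOrder κ]
variable (T : κ → Equiv.Perm S) (U : κ → S → 𝔸ˣ)
variable {g : B9.Geometry} [Fintype g.Site] {Rr : ℝ} {H : Prop}

/-- **THEOREM 3.4, `G`-CLAUSE, ENTRIES (3.42)₁ AND (3.42)₃, WITH `V₃(A)`, `P₁(A)` CONCRETE AND `P(U) = G′Q′*(Q′G′²Q′*)⁻¹Q′G′` WRITTEN OUT** (FILE 11's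
`thm34_G_entries13_concreteV₃P₁` with `hP`/`hDP`/`hPDs` discharged by (3.49), `B9Ineq349Hom.ineq349_hom`).  NEW INPUTS (replacing the three
`P`-entries): a coarse lattice `Z` with block map `blkZ`; `G′ = Gp : Module.End ℝ (S × ι → ℝ)`, `Q′ = Qp : (S × ι → ℝ) →ₗ (Z → ℝ)`, `Q′* = Qps : (Z → ℝ) →ₗ
(S × ι → ℝ)`, `(Q′G′²Q′*)⁻¹ = Cinv : Module.End ℝ (Z → ℝ)`; Theorem 3.1 (3.42)₁ `Gp ≺ B_G(Lʲη)²e^{−δ_G d}`, (3.42)₂ `D ∘ Gp ≺ B_GLʲη e^{−δ_G d}` and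
(3.42)₃ `Gp ∘ D* ≺ B_GLʲη e^{−δ_G d}` with the CONCRETE `D = conjHom b (η⁻¹D¹_U)`, `D* = conjHom b (η⁻¹Σ_νD¹*_{U,ν})`; Theorem 3.2 (3.48)
`Cinv ≺ B₁(Lʲη)⁻⁴e^{−δ_G d}`; `Q′`, `Q′*` block-local with norm `κ_Q`; `δ_P + (2α+β)δ₀ ≦ δ_G`; the scale transfer of `(Lʲη)⁻⁴`; `κ_P = κ₃₄₉(κ_Q, B_G,
B₁, Λ, c₁(β))`.  All other hypotheses and the CONCLUSION are FILE 11's, with `DRD* = D ∘ (1 − G′Q′*C⁻¹Q′G′) ∘ D*` and `D′R′D′* = D′ ∘ (1 − (G′Q′*C⁻¹Q′G′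
+ P′)) ∘ D′*`: a two-sided inverse `G(U′U)` of `Δ_a(U′U)` with `G(U′U) ≺ B₀c₁(α′)(1 − κ₃₈₅′α₁c₁(α′))⁻¹(Lʲη)²e^{−(1−α′)ρd}` and `G(U′U)·∇* ≺
B₀Λ_ρ²c₁(α′)(1 − κ₃₈₅′α₁c₁(α′))⁻¹Lʲη·e^{−(1−3α′)ρd}`.
[cite: Balaban1985BackgroundPropagators, Thm 3.4 p.400 + (3.25) p.394 + (3.49) p.399 + Thm 3.1 (3.42) p.397 + Thm 3.2 (3.48) p.398 + (3.19) p.393 + (3.76)–(3.77) pp.405–406 + (3.82)–(3.86) p.407 + (3.68) p.403 + (3.37)/(3.35) p.396; Balaban1984PropagatorsII, Lemma 2.1 p.234 + (2.51)–(2.55) p.232 + (2.66) p.234; Balaban1985Variational, (135) p.298] -/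
theorem thm34_G_entries13_concreteP [Fintype S] [DecidableEq S] [DecidableEq ι] [DecidableEq g.Site] (blk : S → g.Site) (d : ℕ)
    (δ₀ δ δP δG α β ρ α' Λ Λρ B₀ κQ BG B₁ κP κP' κ₁ κ₂ α₁ C₀ d₀ M₂ : ℝ)
    (hB₀ : 0 ≤ B₀) (hκQ : 0 ≤ κQ) (hBG : 0 ≤ BG) (hB₁ : 0 ≤ B₁) (hκP' : 0 ≤ κP') (hκ₂ : 0 ≤ κ₂) (hα₁ : 0 ≤ α₁) (hC₀ : 0 ≤ C₀) (hΛ : 1 ≤ Λ) (hΛρ : 0 ≤ Λρ)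
    (hρ : 0 ≤ ρ) (hα : 0 ≤ α) (hβ : 0 ≤ β) (hδ₀ : 0 ≤ δ₀) (hδ : 0 ≤ δ) (hM₂ : 0 ≤ M₂) (hr : ρ + (α + β) * δ₀ ≤ δ)
    (hrP : δ + 2 * ((α + β) * δ₀) ≤ δP) (hrG : δP + (2 * α + β) * δ₀ ≤ δG)
    (hκP : κP = kappa349 κQ BG B₁ Λ (B6.c1 d δ₀ β)) (hα' : α' ≤ 1) (hα'ρ0 : 0 ≤ α' * ρ) (hα'ρ2 : 0 ≤ (1 - 2 * α') * ρ)
    (hκ₁ : κ₁ = kappa377 (4 * (1 + Fintype.card κ) * (M₂ * ∑ i, ‖b i‖) * Real.exp (δP * d₀)) κP κP' Λ (B6.c1 d δ₀ β) α₁)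
    (hdnn : ∀ a a' : g.Site, 0 ≤ g.dist a a') (htri : Triangle254 (toB6 g Rr H)) (hrefl : ∀ y : g.Site, g.dist y y = 0)
    (hsym : ∀ y y' : g.Site, g.dist y y' = g.dist y' y) (hlen : ∀ y : g.Site, 0 < g.len y)
    (h261 : Ineq261 d (toB6 g Rr H) δ₀ β) (h261' : Ineq261 d (toB6 g Rr H) ρ α')
    (hT1 : ScaleTransfer g δ₀ α Λ (fun a => g.len a)) (hT2 : ScaleTransfer g δ₀ α Λ (fun a => g.len a ^ 2))
    (hT1i : ScaleTransfer g δ₀ α Λ (fun a => (g.len a)⁻¹)) (hT2i : ScaleTransfer g δ₀ α Λ (fun a => (g.len a ^ 2)⁻¹))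
    (hT4 : ScaleTransfer g δ₀ α Λ (fun a => (g.len a ^ 4)⁻¹))
    (hTρ : ScaleTransfer g ρ α' Λρ (fun a => g.len a))
    (hsmall385 : kappa385 B₀
        (cV385 (Fintype.card κ) α₁ C₀ (M₂ * (∑ i, ‖b i‖) * Real.exp (δ * d₀))
          + ∑ _k ∈ (Finset.univ : Finset (κ ⊕ κ)),
            (10 + 8 * Fintype.card κ + (16 * Fintype.card κ + 12) * C₀) * (M₂ * (∑ i, ‖b i‖) * Real.exp (δ * d₀)))
        κ₁ κ₂ Λ (B6.c1 d δ₀ β) * α₁ * B6.c1 d ρ α' < 1)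
    (hrepr : ∀ (v : 𝔸) (i : ι), |b.repr v i| ≤ M₂ * ‖v‖) (hη : 0 < g.eta) (hL : 1 ≤ g.L) (A : κ → S → 𝔸)
    (hT : ∀ (μ ν : κ) (x : S), T μ (T ν x) = T ν (T μ x))
    (hsmall : ∀ y : g.Site, g.eta * (α₁ * (g.len y)⁻¹) ≤ 1 / 4)
    (hU1 : ∀ m z, ‖((U m z : 𝔸ˣ) : 𝔸)‖ ≤ 1 ∧ ‖(((U m z)⁻¹ : 𝔸ˣ) : 𝔸)‖ ≤ 1)
    -- (3.37) for the exponent field, blockwise, in the shapes files 1–10 read it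
    (h337B : ∀ ν k x, ‖((g.eta : ℂ)⁻¹) • covDstar T U ν (A k) x‖ ≤ α₁ * (g.len (blk x) ^ 2)⁻¹)
    (h337F : ∀ μ ν x, ‖((g.eta : ℂ)⁻¹) • covD T U μ (A ν) x‖ ≤ α₁ * (g.len (blk x) ^ 2)⁻¹)
    (h337B' : ∀ μ ν x, ‖((g.eta : ℂ)⁻¹) • covDstar T U ν (A ν) (T μ x)‖ ≤ α₁ * (g.len (blk x) ^ 2)⁻¹)
    (h337Bτ : ∀ μ x, ‖((g.eta : ℂ)⁻¹) • covDstar T U μ (tauB T U μ (A μ)) x‖ ≤ α₁ * (g.len (blk x) ^ 2)⁻¹)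
    (h337FB : ∀ μ ν k x, ‖((g.eta : ℂ)⁻¹) • covD T U μ (A k) ((T ν).symm x)‖ ≤ α₁ * (g.len (blk x) ^ 2)⁻¹)
    (hA : ∀ k x, ‖A k x‖ ≤ α₁ * (g.len (blk x))⁻¹) (hAτB : ∀ ν k x, ‖tauB T U ν (A k) x‖ ≤ α₁ * (g.len (blk x))⁻¹)
    (hAτF : ∀ μ k x, ‖tauF T U μ (A k) x‖ ≤ α₁ * (g.len (blk x))⁻¹)
    (hAFB : ∀ k μ ν x, ‖A k ((T ν).symm (T μ x))‖ ≤ α₁ * (g.len (blk x))⁻¹)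
    (hAst : ∀ μ x m z, (m, z) ∈ stBonds T μ x → ‖A m z‖ ≤ α₁ * (g.len (blk x))⁻¹)
    (hAloc : ∀ μ x m z, (m, z) ∈ B9Eq375Locality.locBondsA T μ x → ‖A m z‖ ≤ α₁ * (g.len (blk x))⁻¹)
    (hdAst : ∀ μ x m n y, Through T μ x m n y →
      ‖covD T U m (A n) y‖ ≤ g.eta * (α₁ * ((g.len (blk x))⁻¹) ^ 2) ∧
        ‖covD T U n (A m) y‖ ≤ g.eta * (α₁ * ((g.len (blk x))⁻¹) ^ 2))
    -- (3.35) on the plaquettes through each bond, at that bond's block scale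
    (h35 : ∀ μ x m n y, Through T μ x m n y → ‖(plaqU T U m n y : 𝔸) - 1‖ ≤ C₀ * ((g.L ^ g.scale (blk x))⁻¹) ^ 2)
    -- stencil geometry
    (hd₀B : ∀ μ x, g.dist (blk x) (blk ((T μ).symm x)) ≤ d₀) (hd₀F : ∀ μ x, g.dist (blk x) (blk (T μ x)) ≤ d₀)
    (hd₀FB : ∀ μ ν x, g.dist (blk x) (blk ((T ν).symm (T μ x))) ≤ d₀)
    (hd₀st : ∀ μ x (q : κ × S), q ∈ stBonds T μ x → g.dist (blk x) (blk q.2) ≤ d₀)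
    (hd₀loc : ∀ μ x (q : κ × S), q ∈ B9Eq375Locality.locBondsA' T μ x → g.dist (blk x) (blk q.2) ≤ d₀)
    (hd₀0 : ∀ y : g.Site, g.dist y y ≤ d₀)
    -- the letters of `P(U) = G′Q′*(Q′G′²Q′*)⁻¹Q′G′` ((3.25)) typed between their carriers, with Theorem 3.1 (3.42)₁,₂,₃ for `G′(U)`
    -- (the derivative letters concrete), Theorem 3.2 (3.48) for `(Q′G′²Q′*)⁻¹` on the coarse lattice `Z`, `Q′`, `Q′*` block-local ((3.19)), at the rate `δ_G`
    {Z : Type} (blkZ : Z → g.Site)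
    {Gp : Module.End ℝ (S × ι → ℝ)} {Qp : (S × ι → ℝ) →ₗ[ℝ] (Z → ℝ)} {Qps : (Z → ℝ) →ₗ[ℝ] (S × ι → ℝ)} {Cinv : Module.End ℝ (Z → ℝ)}
    (hQp : HasMajorantHom (g := toB6 g Rr H) (fun p : S × ι => blk p.1) blkZ Qp (fun a a' : g.Site => if a = a' then κQ else 0))
    (hQps : HasMajorantHom (g := toB6 g Rr H) blkZ (fun p : S × ι => blk p.1) Qps (fun a a' : g.Site => if a = a' then κQ else 0))
    (hGp : HasMajorant (g := toB6 g Rr H) (fun p : S × ι => blk p.1) Gp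
      (fun a a' => BG * g.len a ^ 2 * Real.exp (-(δG * g.dist a a'))))
    (hDGp : HasMajorantHom (g := toB6 g Rr H) (fun p : S × ι => blk p.1) (fun q : (κ × S) × ι => blk q.1.2)
      (conjHom b (gradLin T ((g.eta : ℂ)⁻¹) U) ∘ₗ Gp) (fun a a' => BG * g.len a * Real.exp (-(δG * g.dist a a'))))
    (hGpDs : HasMajorantHom (g := toB6 g Rr H) (fun q : (κ × S) × ι => blk q.1.2) (fun p : S × ι => blk p.1)
      (Gp ∘ₗ conjHom b (divLin T ((g.eta : ℂ)⁻¹) U)) (fun a a' => BG * g.len a * Real.exp (-(δG * g.dist a a'))))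
    (hCinv : HasMajorant (g := toB6 g Rr H) blkZ Cinv (fun a a' => B₁ * (g.len a ^ 4)⁻¹ * Real.exp (-(δG * g.dist a a'))))
    -- the remainder `P′ = P′(A)` of the site carrier with its typed (3.68) entries at the rate `δ_P`
    {Pp : Module.End ℝ (S × ι → ℝ)}
    (hPp : HasMajorant (g := toB6 g Rr H) (fun p : S × ι => blk p.1) Pp
      (fun a a' => κP' * α₁ * Real.exp (-(δP * g.dist a a'))))
    (hDPp : HasMajorantHom (g := toB6 g Rr H) (fun p : S × ι => blk p.1) (fun q : (κ × S) × ι => blk q.1.2)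
      (conjHom b (gradLin T ((g.eta : ℂ)⁻¹) U) ∘ₗ Pp) (fun a a' => κP' * α₁ * (g.len a)⁻¹ * Real.exp (-(δP * g.dist a a'))))
    (hPpDs : HasMajorantHom (g := toB6 g Rr H) (fun q : (κ × S) × ι => blk q.1.2) (fun p : S × ι => blk p.1)
      (Pp ∘ₗ conjHom b (divLin T ((g.eta : ℂ)⁻¹) U)) (fun a a' => κP' * α₁ * (g.len a)⁻¹ * Real.exp (-(δP * g.dist a a'))))
    (hDPpDs : HasMajorant (g := toB6 g Rr H) (fun q : (κ × S) × ι => blk q.1.2)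
      (conjHom b (gradLin T ((g.eta : ℂ)⁻¹) U) ∘ₗ Pp ∘ₗ conjHom b (divLin T ((g.eta : ℂ)⁻¹) U))
      (fun a a' => κP' * α₁ * (g.len a ^ 2)⁻¹ * Real.exp (-(δP * g.dist a a'))))
    -- the abstract data of (3.80), the inverse property for the concrete `DRD*` and Theorem 3.3 for G(U)
    {G Ds P₂ Qs Qs' Q Q' a F₂ F₂s : Module.End ℝ ((κ × S) × ι → ℝ)}
    (h380 : Q' = Q + F₂) (h380s : Qs' = Qs + F₂s) (hP₂def : P₂ = pTwo Qs Q F₂ F₂s a)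
    (hΔG : deltaA (conj b (lapDDLetter T ((g.eta : ℂ)⁻¹) U)) (conj b (dPrimeLetter T U g.eta))
      (conjHom b (gradLin T ((g.eta : ℂ)⁻¹) U) ∘ₗ (1 - (Gp ∘ₗ Qps ∘ₗ Cinv ∘ₗ Qp ∘ₗ Gp)) ∘ₗ conjHom b (divLin T ((g.eta : ℂ)⁻¹) U)) Qs a Q * G = 1)
    (hGΔ : G * deltaA (conj b (lapDDLetter T ((g.eta : ℂ)⁻¹) U)) (conj b (dPrimeLetter T U g.eta))
      (conjHom b (gradLin T ((g.eta : ℂ)⁻¹) U) ∘ₗ (1 - (Gp ∘ₗ Qps ∘ₗ Cinv ∘ₗ Qp ∘ₗ Gp)) ∘ₗ conjHom b (divLin T ((g.eta : ℂ)⁻¹) U)) Qs a Q = 1)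
    (hP₂ : HasMajorant (g := toB6 g Rr H) (fun q : (κ × S) × ι => blk q.1.2) P₂
      (fun a a' => κ₂ * α₁ * (g.len a ^ 2)⁻¹ * Real.exp (-(δ * g.dist a a'))))
    (hG : HasMajorant (g := toB6 g Rr H) (fun q : (κ × S) × ι => blk q.1.2) G
      (fun a a' => B₀ * g.len a ^ 2 * Real.exp (-(δ * g.dist a a'))))
    (hDG : ∀ k : κ ⊕ κ, HasMajorant (g := toB6 g Rr H) (fun q : (κ × S) × ι => blk q.1.2)
      (conj b (diffLetter (bT T) (bU U) ((g.eta : ℂ)⁻¹) k) * G) (fun a a' => B₀ * g.len a * Real.exp (-(δ * g.dist a a'))))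
    (hGD : ∀ k : κ ⊕ κ, HasMajorant (g := toB6 g Rr H) (fun q : (κ × S) × ι => blk q.1.2)
      (G * conj b (diffLetter (bT T) (bU U) ((g.eta : ℂ)⁻¹) k)) (fun a a' => B₀ * g.len a * Real.exp (-(δ * g.dist a a'))))
    (hGDs : HasMajorant (g := toB6 g Rr H) (fun q : (κ × S) × ι => blk q.1.2) (G * Ds)
      (fun a a' => B₀ * g.len a * Real.exp (-(δ * g.dist a a')))) :
    ∃ GExt : Module.End ℝ ((κ × S) × ι → ℝ),
      deltaA (conj b (lapDDLetter T ((g.eta : ℂ)⁻¹) (prodCfg U g.eta A)))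
          (conj b (dPrimeLetter T (prodCfg U g.eta A) g.eta))
          (conjHom b (gradLin T ((g.eta : ℂ)⁻¹) (prodCfg U g.eta A)) ∘ₗ (1 - ((Gp ∘ₗ Qps ∘ₗ Cinv ∘ₗ Qp ∘ₗ Gp) + Pp))
            ∘ₗ conjHom b (divLin T ((g.eta : ℂ)⁻¹) (prodCfg U g.eta A))) Qs' a Q' * GExt = 1 ∧
      GExt * deltaA (conj b (lapDDLetter T ((g.eta : ℂ)⁻¹) (prodCfg U g.eta A)))
          (conj b (dPrimeLetter T (prodCfg U g.eta A) g.eta))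
          (conjHom b (gradLin T ((g.eta : ℂ)⁻¹) (prodCfg U g.eta A)) ∘ₗ (1 - ((Gp ∘ₗ Qps ∘ₗ Cinv ∘ₗ Qp ∘ₗ Gp) + Pp))
            ∘ₗ conjHom b (divLin T ((g.eta : ℂ)⁻¹) (prodCfg U g.eta A))) Qs' a Q' = 1 ∧
      HasMajorant (g := toB6 g Rr H) (fun q : (κ × S) × ι => blk q.1.2) GExt
        (fun a a' => B₀ * B6.c1 d ρ α' *
          (1 - kappa385 B₀
            (cV385 (Fintype.card κ) α₁ C₀ (M₂ * (∑ i, ‖b i‖) * Real.exp (δ * d₀))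
              + ∑ _k ∈ (Finset.univ : Finset (κ ⊕ κ)),
                (10 + 8 * Fintype.card κ + (16 * Fintype.card κ + 12) * C₀) * (M₂ * (∑ i, ‖b i‖) * Real.exp (δ * d₀)))
            κ₁ κ₂ Λ (B6.c1 d δ₀ β) * α₁ * B6.c1 d ρ α')⁻¹ *
          g.len a ^ 2 * Real.exp (-((1 - α') * ρ * g.dist a a'))) ∧
      HasMajorant (g := toB6 g Rr H) (fun q : (κ × S) × ι => blk q.1.2) (GExt * Ds)
        (fun a a' => B₀ * Λρ ^ 2 * B6.c1 d ρ α' *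
          (1 - kappa385 B₀
            (cV385 (Fintype.card κ) α₁ C₀ (M₂ * (∑ i, ‖b i‖) * Real.exp (δ * d₀))
              + ∑ _k ∈ (Finset.univ : Finset (κ ⊕ κ)),
                (10 + 8 * Fintype.card κ + (16 * Fintype.card κ + 12) * C₀) * (M₂ * (∑ i, ‖b i‖) * Real.exp (δ * d₀)))
            κ₁ κ₂ Λ (B6.c1 d δ₀ β) * α₁ * B6.c1 d ρ α')⁻¹ *
          g.len a * Real.exp (-((1 - 3 * α') * ρ * g.dist a a'))) := by
  have hδP0 : 0 ≤ δP := le_trans (by positivity) hrP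
  have hκP0 : 0 ≤ κP := by
    rw [hκP]; unfold kappa349; positivity
  -- (3.49) for `P(U) = G′Q′*(Q′G′²Q′*)⁻¹Q′G′`, every letter between its carriers (FILE 12), at the output rate `δ_P`
  obtain ⟨hP, hDP, hPDs, -⟩ := ineq349_hom (R := Rr) (H := H) (fun p : S × ι => blk p.1) (fun q : (κ × S) × ι => blk q.1.2) blkZ d
    δ₀ δG α β δP Λ κQ BG B₁ hκQ hBG hB₁ hΛ hδP0 hα hβ hδ₀ hrG hdnn htri hlen h261 hT1 hT2 hT4 hQp hQps hGp hDGp hGpDs hCinv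
  rw [← hκP] at hP hDP hPDs
  exact thm34_G_entries13_concreteV₃P₁ (Rr := Rr) (H := H) b T U blk d δ₀ δ δP α β ρ α' Λ Λρ B₀ κP κP' κ₁ κ₂ α₁ C₀ d₀ M₂ hB₀ hκP0 hκP'
    hκ₂ hα₁ hC₀ hΛ hΛρ hρ hα hβ hδ₀ hδ hM₂ hr hrP hα' hα'ρ0 hα'ρ2 hκ₁ hdnn htri hrefl hsym hlen h261 h261' hT1 hT2 hT1i hT2i hTρ hsmall385
    hrepr hη hL A hT hsmall hU1 h337B h337F h337B' h337Bτ h337FB hA hAτB hAτF hAFB hAst hAloc hdAst h35 hd₀B hd₀F hd₀FB hd₀st hd₀loc hd₀0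
    hP hDP hPDs hPp hDPp hPpDs hDPpDs h380 h380s hP₂def hΔG hGΔ hP₂ hG hDG hGD hGDs

end Assembly

end Literature.MathematicalPhysics.QuantumFieldTheory.Balaban1983to89.B9Ineq349PConcrete

end
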